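import Summits.QuantumFields.BalabanUV.Gaps.CapSignsConstRoad
import Summits.QuantumFields.BalabanUV.Gaps.CapSignsNecessaryFwd

/-!
# Gaps / CapSignListLength — the LENGTH of the CAP sign list on the rate road: no a-priori bound (g1-plan-2 X-66), and its SHARP value —
# exactly the indices `k` with `β⁰_∞ ≤ c₀θ^k` (cell pub-balaban-gaps, seat g1-p3 gen 4, CAP+tail charge; §1 ADOPTS §5 (X-66) of g1-plan-2
# GEN 10's lens kernel `g1/skeletons/XreadSchemeSocketWeakest_plan2.lean` v4 89567fc414f9f85b byte-for-byte, on the planner's «no refusal»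
# disposition [G1-PLAN2-G10-X66-X67]; §§2–3 are this seat's — and were INDEPENDENTLY re-derived, from the bus wording alone, by g1-plan-2
# GEN 11's kernel `g1/skeletons/XreadIndexTest_plan2.lean` 1fb8a537bd51a8c2 (XREAD X-70: `tailFloor_of_index` ≡ `tail_floor_sharp`,
# `uniformFloor_of_index_signs` ≡ `floor_of_signs_below`, `indexTest_sharp` ⊆ `rate_allows_nonpos_at`, `indexTest_at_k₀` ≡ `k₀_passes_sharp`,
# `thm2Printed_of_indexTest` ≡ `thm2Printed_of_signs_sharpList` up to the road taken))

HONEST FRAMING (cell rule, page 1 of everything): bookkeeping over hypothesis SHAPES of the tree's β sub-cell; NOTHING of Bałaban's is asserted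
beyond print; [Balaban1987RG1] Thm 2 is UNPROVED IN PRINT and enters only as the conclusion ∕ hypothesis `B12.Thm2Printed C L`; the rate
constants `β⁰_∞, c₀, θ` are HYPOTHESES (`Beta.RateCertificate.GeomRate`, `Beta.Assembly.LimitForm`; rows NE4 ∕ G-an2-4; unprinted — [I] p. 264
«other properties in a separate paper»); NO coefficient of Bałaban's β⁰ is certified to date (b2b BETA/CERT.md: «0 coefficients»); 0 binders
discharged; NOT `BetaPertH`, NOT the continuum limit, NOT Clay.  HONEST DEPENDENCY (b2b cell, verbatim): «continuum YM on T⁴ ⇐ BetaPertH ∧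
nine spine estimates (0/9 proved); BetaPertH ⇐ (D1) ∧ (D4) ∧ CAP+tail; G-an2-4 gates asym, D1 and NE2/3/4.»

CONTENT.
§1 (X-66) `prefix_length_unbounded` ∕ `_cert`: the sign list `∀ k < k₂, 0 < β⁰_{k+1}` of every positive CAP socket
   (`CapSignsConstRoad.exists_beta0Floor_of_signs`; `CapTailSigns.thm2Printed_of_signs` with `LimitForm.k₀ = Nat.find (c₀θ^{k₀} ≤ β⁰_∞∕4)`)
   has NO a-priori length — for every `K` there are admissible tail constants forcing `k₂ ≥ K`: a certified computation of finitely many signs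
   (CA-1 ∕ (M): k ≤ 2) is not KNOWN to exhaust the list until the rate constants are certified.
§2 (this seat) THE SHARP LENGTH.  The tree's suppliers ask signs below an index passing `c₀θ^{k} ≤ β⁰_∞∕4` (`Beta.Assembly.LimitForm.k₀`,
   `CapTailSigns.thm2Printed_of_signs_list`, `CapSignsConstRoad.exists_beta0Floor_of_signs`) or `θ^{k} < β⁰_∞∕(2(c₀+1))`
   (`CapTailFloors.eventualFloor_of_geomRate`).  The STRICT test `c₀θ^K < β⁰_∞` already suffices (`floor_of_signs_below`; certified form
   `floor_of_signs_below_cert` with test `c₀θ^K + c₀θ^{k₁} < m`) AND IT IS SHARP: whenever `β⁰_∞ ≤ c₀θ^k` the rate ALLOWS a nonpositive `k`-th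
   coefficient (`rate_allows_nonpos_at`); hence `signsBelow_give_floor_iff` ∕ `signsBelow_give_allSigns_iff` («rate + signs below `K` ⟹ floor ∕
   all signs, for EVERY sequence» ⟺ `c₀θ^K < β⁰_∞`) and `capSet_exact` (certified signs on a set `I` force all signs under the rate ⟺
   `{k ∣ β⁰_∞ ≤ c₀θ^k} ⊆ I`; `capSet_empty_iff`: that set is EMPTY iff `c₀ < β⁰_∞`); `prefix_length_unbounded_sharp` is X-66 for the sharp test.
§3 (this seat) ON THE LIMIT-FORM ROAD: `k₀_passes_sharp`; **`thm2Printed_of_signs_sharpList`** ([I] Theorem 2 as printed from `LimitForm` + signs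
   below ANY `K` with `c₀θ^K < β⁰_∞`, forward generation, `L > 1`), `_posRows_` (certified-row currency), **`thm2Printed_of_c₀_lt_binf`** (NO CAP AT ALL when `c₀ < β⁰_∞`; the tree's CAP-free case needs `c₀ ≤ β⁰_∞∕4`), **`thm2Printed_iff_signs_sharpList_fwd`**
   (the exact residue at the sharp length, off the boundary), `sharp_saves_two_halvings` (numbers).
READING for row CAP-k: given the (unprinted) tail constants, the CAP list a certificate must deliver on the rate road is EXACTLY the initial
segment `{k ∣ β⁰_∞ ≤ c₀θ^k}` — shorter than the tree's `k₀` by the indices the factor `1∕4` costs (`⌈log 4 ∕ log θ⁻¹⌉` of them), and not one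
index shorter on this road.  All [folklore]; 0 sorry; 0 def; imports tree files only; restates nothing.
-/

namespace Summit.QuantumFields.BalabanUV.Gaps.CapSignListLength

open Literature.MathematicalPhysics.QuantumFieldTheory.Balaban1983to89
open Literature.MathematicalPhysics.QuantumFieldTheory.Balaban1983to89.FlowStep
open Literature.MathematicalPhysics.QuantumFieldTheory.Balaban1983to89.DagBinding
open Literature.MathematicalPhysics.QuantumFieldTheory.Balaban1983to89.Beta.RateCertificate (GeomRate)
open Summit.QuantumFields.BalabanUV.Gaps.CapSignsConstRoad (exists_pos_floor_of_signs)
open Summit.QuantumFields.BalabanUV.Gaps.CapSignsNecessaryFwd (beta0_nonneg_of_thm2Printed_fwd_limitForm)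

noncomputable section

/-! ## §1 (X-66) The sign list's length is fixed by the tail constants; no a-priori bound -/

/-- **X-66.**  For every `K` there are tail constants `β⁰_∞ = 1 > 0`, `c₀ = 2^K ≥ 0`, `θ = 1∕2 ∈ [0,1[` (the shape of `Beta.Assembly.LimitForm`'s
fields `binf`, `c₀`, `θ` and of the binders `hconv` ∕ `hk₂` of `CapSignsConstRoad.exists_beta0Floor_of_signs`) under which EVERY admissible
sign-list length `k₂` (`c₀θ^{k₂} ≤ β⁰_∞∕4`) is at least `K`.  So the number of early signs a certificate must deliver is not bounded before the
rate constants are known ([I] p.264: «other properties in a separate paper»). [folklore] -/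
theorem prefix_length_unbounded (K : ℕ) :
    ∃ binf c₀ θ : ℝ, 0 < binf ∧ 0 ≤ c₀ ∧ 0 ≤ θ ∧ θ < 1 ∧ ∀ k₂ : ℕ, c₀ * θ ^ k₂ ≤ binf / 4 → K ≤ k₂ := by
  refine ⟨1, 2 ^ K, 1 / 2, one_pos, by positivity, by norm_num, by norm_num, fun k₂ hk => not_lt.mp fun hlt => ?_⟩
  have h1 : (2 : ℝ) ^ k₂ * (1 / 2) ^ k₂ = 1 := by rw [← mul_pow]; norm_num
  have h2 : (2 : ℝ) ^ (k₂ + 1) ≤ 2 ^ K := pow_le_pow_right₀ (by norm_num) (Nat.succ_le_of_lt hlt)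
  have h3 : (2 : ℝ) ≤ 2 ^ K * (1 / 2) ^ k₂ :=
    calc (2 : ℝ) = 2 ^ (k₂ + 1) * (1 / 2) ^ k₂ := by rw [pow_succ]; linarith [h1]
      _ ≤ 2 ^ K * (1 / 2) ^ k₂ := mul_le_mul_of_nonneg_right h2 (by positivity)
  linarith

/-- The same with a certified value `m` at index `k₁` in the `exists_beta0Floor_of_signs` shape `c₀θ^{k₂} ≤ (m − c₀θ^{k₁})∕4`: with
`m ≤ β⁰_∞ = 1` the admissible `k₂` are among those of `prefix_length_unbounded`, hence `≥ K`. [folklore] -/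
theorem prefix_length_unbounded_cert (K : ℕ) :
    ∃ binf c₀ θ : ℝ, 0 < binf ∧ 0 ≤ c₀ ∧ 0 ≤ θ ∧ θ < 1 ∧
      ∀ (m : ℝ) (k₁ k₂ : ℕ), m ≤ binf → c₀ * θ ^ k₂ ≤ (m - c₀ * θ ^ k₁) / 4 → K ≤ k₂ := by
  obtain ⟨binf, c₀, θ, hb, hc, hθ0, hθ1, h⟩ := prefix_length_unbounded K
  refine ⟨binf, c₀, θ, hb, hc, hθ0, hθ1, fun m k₁ k₂ hm hk => h k₂ (hk.trans ?_)⟩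
  have : 0 ≤ c₀ * θ ^ k₁ := by positivity
  linarith


/-! ## §2 (this seat) THE SHARP LENGTH OF THE SIGN LIST on the rate road: exactly the indices `k` with `β⁰_∞ ≤ c₀θ^k` -/

/-- Tail floor at the SHARP index test: `GeomRate b β⁰_∞ c₀ θ`, `0 ≤ θ ≤ 1` ⟹ `β⁰_∞ − c₀θ^K ≤ b_k` for every `k ≥ K` (the tree's
`RemainderConstCertified.tail_floor_of_cert` ∕ `Assembly.LimitForm.beta0_ge_of_le` spend a factor `3∕4` here). [folklore] -/
theorem tail_floor_sharp {b : ℕ → ℝ} {binf c₀ θ : ℝ} (hconv : GeomRate b binf c₀ θ) (hθ0 : 0 ≤ θ) (hθ1 : θ ≤ 1) {K : ℕ} :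
    ∀ k, K ≤ k → binf - c₀ * θ ^ K ≤ b k := fun k hk => by
  have h1 := (abs_le.mp (hconv k)).1
  have h2 : c₀ * θ ^ k ≤ c₀ * θ ^ K := mul_le_mul_of_nonneg_left (pow_le_pow_of_le_one hθ0 hθ1 hk) hconv.const_nonneg
  linarith

/-- **SUFFICIENCY AT THE SHARP TEST**: rate + `0 ≤ θ ≤ 1` + the STRICT test `c₀θ^K < β⁰_∞` + the signs below `K` ⟹ a uniform positive
floor `min m₀ (β⁰_∞ − c₀θ^K)` of the whole sequence (`m₀` the listed minimum, `CapSignsConstRoad.exists_pos_floor_of_signs`).  The tree's index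
tests (`c₀θ^{k} ≤ β⁰_∞∕4`, `LimitForm.k₀`; `θ^{k} < β⁰_∞∕(2(c₀+1))`, `CapTailFloors.eventualFloor_of_geomRate`) are stronger. [folklore] -/
theorem floor_of_signs_below {b : ℕ → ℝ} {binf c₀ θ : ℝ} (hconv : GeomRate b binf c₀ θ) (hθ0 : 0 ≤ θ) (hθ1 : θ ≤ 1)
    {K : ℕ} (hK : c₀ * θ ^ K < binf) (hsign : ∀ k, k < K → 0 < b k) : ∃ f : ℝ, 0 < f ∧ ∀ k, f ≤ b k := by
  obtain ⟨m₀, hm₀, hlist⟩ := exists_pos_floor_of_signs b K hsign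
  refine ⟨min m₀ (binf - c₀ * θ ^ K), lt_min hm₀ (sub_pos.mpr hK), fun k => ?_⟩
  rcases lt_or_ge k K with hk | hk
  · exact (min_le_left _ _).trans (hlist k hk)
  · exact (min_le_right _ _).trans (tail_floor_sharp hconv hθ0 hθ1 k hk)

/-- **CERTIFIED FORM** (β⁰_∞ not known, ONE certified lower value `m ≤ b_{k₁}`, `GeomRate.binf_ge`): the test `c₀θ^K < m − c₀θ^{k₁}` (i.e.
`c₀θ^K + c₀θ^{k₁} < m`; it contains the gap `c₀θ^{k₁} < m`) + signs below `K` ⟹ a uniform positive floor.  Compare the tree's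
`exists_beta0Floor_of_signs` (test `c₀θ^{k₂} ≤ (m − c₀θ^{k₁})∕4` + separate gap). [folklore] -/
theorem floor_of_signs_below_cert {b : ℕ → ℝ} {binf c₀ θ m : ℝ} {k₁ K : ℕ} (hconv : GeomRate b binf c₀ θ) (hθ0 : 0 ≤ θ)
    (hθ1 : θ ≤ 1) (hcert : m ≤ b k₁) (hK : c₀ * θ ^ K < m - c₀ * θ ^ k₁) (hsign : ∀ k, k < K → 0 < b k) :
    ∃ f : ℝ, 0 < f ∧ ∀ k, f ≤ b k :=
  floor_of_signs_below hconv hθ0 hθ1 (hK.trans_le (hconv.binf_ge hcert)) hsign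

/-- **NECESSITY OF EACH LISTED INDEX (the witness).**  If `β⁰_∞ ≤ c₀θ^k` then the rate ALLOWS a nonpositive `k`-th coefficient: the sequence
`b_j := β⁰_∞` (`j ≠ k`), `b_k := β⁰_∞ − c₀θ^k ≤ 0` satisfies `GeomRate b β⁰_∞ c₀ θ`.  So no road «rate + limit value + certified signs on a set
omitting `k`» can conclude the sign at `k`. [folklore] -/
theorem rate_allows_nonpos_at {binf c₀ θ : ℝ} (hc₀ : 0 ≤ c₀) (hθ0 : 0 ≤ θ) {k : ℕ} (hk : binf ≤ c₀ * θ ^ k) :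
    ∃ b : ℕ → ℝ, GeomRate b binf c₀ θ ∧ b k ≤ 0 ∧ ∀ j, j ≠ k → b j = binf := by
  refine ⟨fun j => if j = k then binf - c₀ * θ ^ k else binf, fun j => ?_, ?_, fun j hj => ?_⟩
  · show |(if j = k then binf - c₀ * θ ^ k else binf) - binf| ≤ c₀ * θ ^ j
    by_cases hj : j = k
    · rw [if_pos hj, hj, show binf - c₀ * θ ^ k - binf = -(c₀ * θ ^ k) by ring, abs_neg,
        abs_of_nonneg (mul_nonneg hc₀ (pow_nonneg hθ0 k))]
    · rw [if_neg hj, sub_self, abs_zero]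
      exact mul_nonneg hc₀ (pow_nonneg hθ0 j)
  · show (if k = k then binf - c₀ * θ ^ k else binf) ≤ 0
    rw [if_pos rfl]
    linarith
  · show (if j = k then binf - c₀ * θ ^ k else binf) = binf
    rw [if_neg hj]

/-- **THE EXACT CHARACTERISATION, floor form.**  For `0 < β⁰_∞`, `0 ≤ c₀`, `0 ≤ θ ≤ 1` and a list length `K`: «every sequence with the rate
and positive signs below `K` has a uniform positive floor» ⟺ `c₀θ^K < β⁰_∞`. (⇐ `floor_of_signs_below`; ⇒ the witness of `rate_allows_nonpos_at`
at index `K` has all listed signs — its early values are `β⁰_∞ > 0` — and no positive floor.) [folklore] -/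
theorem signsBelow_give_floor_iff {binf c₀ θ : ℝ} (hbinf : 0 < binf) (hc₀ : 0 ≤ c₀) (hθ0 : 0 ≤ θ) (hθ1 : θ ≤ 1) (K : ℕ) :
    (∀ b : ℕ → ℝ, GeomRate b binf c₀ θ → (∀ k, k < K → 0 < b k) → ∃ f : ℝ, 0 < f ∧ ∀ k, f ≤ b k) ↔
      c₀ * θ ^ K < binf := by
  refine ⟨fun h => lt_of_not_ge fun hK => ?_, fun hK b hconv hsign => floor_of_signs_below hconv hθ0 hθ1 hK hsign⟩
  obtain ⟨b, hb, hk, hother⟩ := rate_allows_nonpos_at hc₀ hθ0 hK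
  obtain ⟨f, hf, hF⟩ := h b hb fun k hk' => by rw [hother k hk'.ne]; exact hbinf
  linarith [hF K]

/-- **THE EXACT CHARACTERISATION, sign form.**  Same hypotheses: «every sequence with the rate and positive signs below `K` has ALL signs
positive» ⟺ `c₀θ^K < β⁰_∞`. [folklore] -/
theorem signsBelow_give_allSigns_iff {binf c₀ θ : ℝ} (hbinf : 0 < binf) (hc₀ : 0 ≤ c₀) (hθ0 : 0 ≤ θ) (hθ1 : θ ≤ 1) (K : ℕ) :
    (∀ b : ℕ → ℝ, GeomRate b binf c₀ θ → (∀ k, k < K → 0 < b k) → ∀ k, 0 < b k) ↔ c₀ * θ ^ K < binf := by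
  refine ⟨fun h => lt_of_not_ge fun hK => ?_, fun hK b hconv hsign k => ?_⟩
  · obtain ⟨b, hb, hk, hother⟩ := rate_allows_nonpos_at hc₀ hθ0 hK
    have := h b hb (fun k hk' => by rw [hother k hk'.ne]; exact hbinf) K
    linarith
  · obtain ⟨f, hf, hF⟩ := floor_of_signs_below hconv hθ0 hθ1 hK hsign
    exact hf.trans_le (hF k)

/-- **THE CAP LIST IS EXACTLY `{k ∣ β⁰_∞ ≤ c₀θ^k}`** (no monotonicity of `θ^k` needed): for `0 < β⁰_∞`, `0 ≤ c₀`, `0 ≤ θ` and ANY set `I` of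
indices, «every sequence with the rate whose signs on `I` are positive has all signs positive» ⟺ `{k ∣ β⁰_∞ ≤ c₀θ^k} ⊆ I`.  For `θ ≤ 1` that
set is an initial segment; given the (unprinted) tail constants it is THE list a CAP certificate must deliver on this road — not one index
less. [folklore] -/
theorem capSet_exact {binf c₀ θ : ℝ} (hbinf : 0 < binf) (hc₀ : 0 ≤ c₀) (hθ0 : 0 ≤ θ) (I : Set ℕ) :
    (∀ b : ℕ → ℝ, GeomRate b binf c₀ θ → (∀ k ∈ I, 0 < b k) → ∀ k, 0 < b k) ↔ {k | binf ≤ c₀ * θ ^ k} ⊆ I := by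
  refine ⟨fun h k₀ (hk₀ : binf ≤ c₀ * θ ^ k₀) => Classical.by_contradiction fun hI => ?_, fun hI b hconv hsign k => ?_⟩
  · obtain ⟨b, hb, hk, hother⟩ := rate_allows_nonpos_at hc₀ hθ0 hk₀
    have := h b hb (fun k hk' => by rw [hother k fun h' => hI (h' ▸ hk')]; exact hbinf) k₀
    linarith
  · by_cases hk : k ∈ I
    · exact hsign k hk
    · have hlt : c₀ * θ ^ k < binf := lt_of_not_ge fun h' => hk (hI h')
      have h1 := (abs_le.mp (hconv k)).1
      linarith

/-- **THE LIST IS EMPTY iff `c₀ < β⁰_∞`** (`0 ≤ θ ≤ 1`, `0 ≤ c₀`): the set `{k ∣ β⁰_∞ ≤ c₀θ^k}` of indices a CAP certificate must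
deliver is empty exactly when the rate constant is below the limit value — then the rate ALONE gives every sign (the tree's CAP-free case
`Assembly.LimitForm.k₀_eq_zero` ∕ `CapTailSigns.thm2Printed_of_k₀_eq_zero` asks `c₀ ≤ β⁰_∞∕4`). [folklore] -/
theorem capSet_empty_iff {binf c₀ θ : ℝ} (hc₀ : 0 ≤ c₀) (hθ0 : 0 ≤ θ) (hθ1 : θ ≤ 1) :
    {k : ℕ | binf ≤ c₀ * θ ^ k} = ∅ ↔ c₀ < binf := by
  rw [Set.eq_empty_iff_forall_notMem]
  refine ⟨fun h => lt_of_not_ge fun hle => h 0 ?_, fun h k (hk : binf ≤ c₀ * θ ^ k) => ?_⟩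
  · show binf ≤ c₀ * θ ^ 0
    rw [pow_zero, mul_one]
    exact hle
  · have : c₀ * θ ^ k ≤ c₀ := mul_le_of_le_one_right hc₀ (pow_le_one₀ hθ0 hθ1)
    linarith

/-- **X-66 for the sharp test**: for every `K` there are admissible tail constants (`β⁰_∞ = 1`, `c₀ = 2^K`, `θ = 1∕2`) under which every list
length passing even the SHARP test `c₀θ^{K'} < β⁰_∞` is `> K`.  The sharp list is still not bounded a priori. [folklore] -/
theorem prefix_length_unbounded_sharp (K : ℕ) :
    ∃ binf c₀ θ : ℝ, 0 < binf ∧ 0 ≤ c₀ ∧ 0 ≤ θ ∧ θ < 1 ∧ ∀ K' : ℕ, c₀ * θ ^ K' < binf → K < K' := by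
  refine ⟨1, 2 ^ K, 1 / 2, one_pos, by positivity, by norm_num, by norm_num, fun K' hK' => not_le.mp fun hle => ?_⟩
  have h1 : (2 : ℝ) ^ K' * (1 / 2) ^ K' = 1 := by rw [← mul_pow]; norm_num
  have h2 : (2 : ℝ) ^ K' ≤ 2 ^ K := pow_le_pow_right₀ (by norm_num) hle
  have h3 : (1 : ℝ) ≤ 2 ^ K * (1 / 2) ^ K' :=
    calc (1 : ℝ) = 2 ^ K' * (1 / 2) ^ K' := h1.symm
      _ ≤ 2 ^ K * (1 / 2) ^ K' := mul_le_mul_of_nonneg_right h2 (by positivity)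
  linarith

/-! ## §3 (this seat) The sharp list on the limit-form road (`Beta.Assembly.LimitForm`) -/

variable {β : HBeta}

/-- The limit form's `k₀` PASSES the sharp test (`c₀θ^{k₀} ≤ β⁰_∞∕4 < β⁰_∞`): the sharp list is never longer than the tree's. [folklore] -/
theorem k₀_passes_sharp (D : Beta.Assembly.LimitForm β) : D.c₀ * D.θ ^ D.k₀ < D.binf :=
  lt_of_le_of_lt D.k₀_spec (by linarith [D.binf_pos])

/-- **[Balaban1987RG1] THEOREM 2 AS PRINTED FROM THE LIMIT FORM + THE SHARP SIGN LIST** (forward generation, real block size `L > 1`): ANY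
`K` with the STRICT test `c₀θ^K < β⁰_∞` and `0 < β⁰_{k+1}` for `k < K` ⟹ `B12.Thm2Printed C L` (floor by `floor_of_signs_below`, then the
tree's `CapTailSigns.thm2Printed_of_signs`, whose own list below `LimitForm.k₀` is implied by the floor).  The tree's list head
`CapTailSigns.thm2Printed_of_signs_list` asks `c₀θ^{k₁} ≤ β⁰_∞∕4`. [cite: Balaban1987RG1, Thm 2 (0.31) p.259] -/
theorem thm2Printed_of_signs_sharpList (D : Beta.Assembly.LimitForm β) {C : B12.Construction} (hgen : ForwardGenerated C β) {L : ℝ}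
    (hL : 1 < L) {K : ℕ} (hK : D.c₀ * D.θ ^ K < D.binf) (hsign : ∀ k, k < K → 0 < D.S.β0 k) : B12.Thm2Printed C L := by
  obtain ⟨f, hf, hF⟩ := floor_of_signs_below (fun k => D.conv k) D.θ_nonneg D.θ_lt_one.le hK hsign
  exact CapTailSigns.thm2Printed_of_signs D hgen hL fun k _ => hf.trans_le (hF k)

/-- Certified-row currency (cf. `CapTailSigns.thm2Printed_of_posRows`): rational lower bounds `0 < lo k ≤ β⁰_{k+1}` for `k < K` at the
sharp test. [cite: Balaban1987RG1, Thm 2 (0.31) p.259] -/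
theorem thm2Printed_of_posRows_sharpList (D : Beta.Assembly.LimitForm β) {C : B12.Construction} (hgen : ForwardGenerated C β) {L : ℝ}
    (hL : 1 < L) {K : ℕ} (hK : D.c₀ * D.θ ^ K < D.binf) (lo : ℕ → ℚ) (hlo : ∀ k, k < K → ((lo k : ℚ) : ℝ) ≤ D.S.β0 k)
    (hpos : ∀ k, k < K → 0 < lo k) : B12.Thm2Printed C L :=
  thm2Printed_of_signs_sharpList D hgen hL hK fun k hk => lt_of_lt_of_le (by exact_mod_cast hpos k hk) (hlo k hk)

/-- **NO CAP AT ALL WHEN THE RATE CONSTANT IS BELOW THE LIMIT** (the sharp test at `K = 0`): `LimitForm β` with `c₀ < β⁰_∞` ⟹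
[I] Theorem 2 as printed for every forward-generated construction and every `L > 1` — no sign is asked of any coefficient.  The tree's
`CapTailSigns.thm2Printed_of_k₀_eq_zero` needs `k₀ = 0`, i.e. `c₀ ≤ β⁰_∞∕4` (`LimitForm.k₀_le`). [cite: Balaban1987RG1, Thm 2 (0.31) p.259] -/
theorem thm2Printed_of_c₀_lt_binf (D : Beta.Assembly.LimitForm β) {C : B12.Construction} (hgen : ForwardGenerated C β) {L : ℝ}
    (hL : 1 < L) (h : D.c₀ < D.binf) : B12.Thm2Printed C L :=
  thm2Printed_of_signs_sharpList D hgen hL (K := 0) (by rw [pow_zero, mul_one]; exact h)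
    fun k hk => absurd hk (Nat.not_lt_zero k)

/-- **THE EXACT RESIDUE AT THE SHARP LENGTH** (limit-form road, off the boundary, forward generation only): for any `K` passing the strict
test, `B12.Thm2Printed C L ↔ ∀ k < K, 0 < β⁰_{k+1}` (⇒ by (N1) `CapSignsNecessaryFwd.beta0_nonneg_of_thm2Printed_fwd_limitForm` + `β⁰_{k+1} ≠ 0`
below `K`).  With `capSet_exact`: on this road the (0.31) residue is the sign list on EXACTLY `{k ∣ β⁰_∞ ≤ c₀θ^k}`.
[cite: Balaban1987RG1, Thm 2 (0.31) p.259] -/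
theorem thm2Printed_iff_signs_sharpList_fwd (D : Beta.Assembly.LimitForm β) {C : B12.Construction} (hgen : ForwardGenerated C β)
    {L : ℝ} (hL : 1 < L) {K : ℕ} (hK : D.c₀ * D.θ ^ K < D.binf) (hne : ∀ k, k < K → D.S.β0 k ≠ 0) :
    B12.Thm2Printed C L ↔ ∀ k, k < K → 0 < D.S.β0 k :=
  ⟨fun h k hk => lt_of_le_of_ne (beta0_nonneg_of_thm2Printed_fwd_limitForm D hgen hL h k) (hne k hk).symm,
    fun hsign => thm2Printed_of_signs_sharpList D hgen hL hK hsign⟩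

/-- NUMBERS (how much shorter): with `θ = 1∕2` the tree's test `c₀θ^k ≤ β⁰_∞∕4` needs two more halvings than the sharp `c₀θ^k < β⁰_∞` can
use — e.g. `β⁰_∞ = c₀ = 1`: the sharp test passes at `K = 1` (`1∕2 < 1`) while `c₀θ^k ≤ 1∕4` first holds at `k = 2`; in general the saving
is the `⌈log 4 ∕ log θ⁻¹⌉`-odd indices the factor `1∕4` costs. [folklore] -/
theorem sharp_saves_two_halvings :
    (1 : ℝ) * (1 / 2) ^ 1 < 1 ∧ ¬ ((1 : ℝ) * (1 / 2) ^ 1 ≤ 1 / 4) ∧ (1 : ℝ) * (1 / 2) ^ 2 ≤ 1 / 4 := by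
  norm_num

end

end Summit.QuantumFields.BalabanUV.Gaps.CapSignListLength
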